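import Mathlib
import Summits.Ventures.PercRepro2.Defs
import Summits.Ventures.PercRepro2.Independence
import Summits.Ventures.PercRepro2.Graph
import Summits.Ventures.PercRepro2.Events
import Summits.Ventures.PercRepro2.Frontier
import Summits.Ventures.PercRepro2.BHKAvoid
import Summits.Ventures.PercRepro2.R2PrimeThreeReduction
import Summits.Ventures.PercRepro2.YBridge
import Summits.Ventures.PercRepro2.HCov
import Summits.Ventures.PercRepro2.BasePendant
import Summits.Ventures.PercRepro2.TwoTerminalReduction

/-!
# A pendant `a₃`: the leaf edge, pinned (blind cell PercRepro2, mine-2 g22; row 2′BETA1 / the weighted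
(PM) dictionary, proofs/MINE2-CUTU.md §13; first file)

`a₃` is a LEAF of the graph, its only edge `f = {a₃, u}` of weight `t = p f`.  Every mass of the
covariance form `Gc` (`HCov.lean`) is a probability of an event of the connectivity relation, so by the
pinning identity `prob_eq_pin` it is `t · (mass at p[f ↦ 1]) + (1 − t) · (mass at p[f ↦ 0])`
(`prob_PD_pin`, `Do_pin`, …).  With the leaf edge pinned OPEN, `a₃` is connected to exactly what `u` is
(`conn_leaf_open`), so every `a₃`-mass at `p[f ↦ 1]` is the same mass function at `p[f ↦ 0]` with `u` in
the place of `a₃` (`prob_PD_one`, `Do_one`, `EQb3_one`, …); with the leaf edge pinned CLOSED, `a₃` is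
isolated, so the `T`-masses (`a₃` in a root cluster) vanish (`EQb3_zero`, `EQb3o_zero`, `EQ3_zero`,
`EQ3o_zero`).  The `a₃`-free masses (`P(Q)`, `E_Q[σ_b σ_o]`, `gap`, `E_Q[σ_o]`) do not see `f` at all
(`DependsOn`, `prob_update_of_dependsOn`).  `PMPendantDict.lean` assembles the dictionary.
-/

namespace Summit.Ventures.PercRepro2

open CovForm UnionCluster

namespace PMPendant

section Graph

variable {V : Type*} {E : Type*} {ends : E → Sym2 V} {a₃ u : V} {f : E}

/-- Connections INTO the leaf, with the leaf edge open: `v ↔ a₃` iff `v ↔ u`. -/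
lemma conn_leaf_open' (hf : ends f = s(a₃, u)) {ω : Config E} (hω : ω f = true) {v : V} :
    Conn ends ω v a₃ ↔ Conn ends ω v u :=
  ⟨fun h => conn_symm ((conn_leaf_open hf hω).1 (conn_symm h)),
    fun h => conn_symm ((conn_leaf_open hf hω).2 (conn_symm h))⟩

/-- With the leaf edge closed, no other vertex reaches the leaf. -/
lemma conn_leaf_closed_iff (hf : ends f = s(a₃, u)) (hleaf : ∀ e, a₃ ∈ ends e → e = f)
    (h3u : a₃ ≠ u) {ω : Config E} (hω : ω f = false) {v : V} (hv : v ≠ a₃) :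
    Conn ends ω v a₃ ↔ False :=
  ⟨fun h => hv (conn_leaf_closed hf hleaf h3u hω (conn_symm h)), False.elim⟩

/-- With the leaf edge closed, the leaf reaches no other vertex. -/
lemma conn_leaf_closed_iff' (hf : ends f = s(a₃, u)) (hleaf : ∀ e, a₃ ∈ ends e → e = f)
    (h3u : a₃ ≠ u) {ω : Config E} (hω : ω f = false) {v : V} (hv : v ≠ a₃) :
    Conn ends ω a₃ v ↔ False :=
  ⟨fun h => hv (conn_leaf_closed hf hleaf h3u hω h), False.elim⟩

/-- A connection between two vertices other than the leaf does not see the leaf edge. -/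
lemma dependsOn_connEvent_leaf (hf : ends f = s(a₃, u)) (hleaf : ∀ e, a₃ ∈ ends e → e = f)
    (h3u : a₃ ≠ u) {x y : V} (hx : x ≠ a₃) (hy : y ≠ a₃) :
    DependsOn (· ∈ connEvent ends x y) ({f}ᶜ : Set E) := by
  intro ω ω' h
  have hagree : ∀ e, e ≠ f → ω e = ω' e := fun e he => h e (by simpa using he)
  have hagree' : ∀ e, e ≠ f → ω' e = ω e := fun e he => (hagree e he).symm
  exact propext ⟨conn_of_conn_of_eq_off_leaf hf hleaf h3u hagree hx hy,
    conn_of_conn_of_eq_off_leaf hf hleaf h3u hagree' hx hy⟩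

end Graph

section Prob

variable {V : Type*} {E : Type*} [Fintype E] [DecidableEq E] {R : Type*} [Field R]
  {ends : E → Sym2 V} {a₃ u : V} {f : E}

/-- Under `p[f ↦ 1]`, an event that agrees on `{f open}` with an event `X'` not seeing `f` has the
probability of `X'` under `p[f ↦ 0]`. -/
lemma prob_one_eq (p : E → R) {X X' : Set (Config E)}
    (h : ∀ ω : Config E, ω f = true → (ω ∈ X ↔ ω ∈ X'))
    (hX' : DependsOn (· ∈ X') ({f}ᶜ : Set E)) :
    prob (Function.update p f 1) X = prob (Function.update p f 0) X' := by
  rw [← prob_update_one_inter_openEdge p X f]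
  have e : X ∩ openEdge f = X' ∩ openEdge f := by
    ext ω
    simp only [Set.mem_inter_iff, mem_openEdge]
    constructor
    · rintro ⟨hx, ho⟩; exact ⟨(h ω ho).1 hx, ho⟩
    · rintro ⟨hx, ho⟩; exact ⟨(h ω ho).2 hx, ho⟩
  rw [e, prob_update_one_inter_openEdge, RootPairSep.prob_update_of_dependsOn p hX' (by simp) 1,
    RootPairSep.prob_update_of_dependsOn p hX' (by simp) 0]

/-- Under `p[f ↦ 0]`, two events that agree on `{f closed}` have the same probability. -/
lemma prob_zero_eq (p : E → R) {X X' : Set (Config E)}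
    (h : ∀ ω : Config E, ω f = false → (ω ∈ X ↔ ω ∈ X')) :
    prob (Function.update p f 0) X = prob (Function.update p f 0) X' := by
  rw [← prob_update_zero_inter_closedEdge p X f, ← prob_update_zero_inter_closedEdge p X' f]
  congr 1
  ext ω
  simp only [Set.mem_inter_iff, mem_closedEdge]
  constructor
  · rintro ⟨hx, hc⟩; exact ⟨(h ω hc).1 hx, hc⟩
  · rintro ⟨hx, hc⟩; exact ⟨(h ω hc).2 hx, hc⟩

/-- Under `p[f ↦ 0]`, an event that is empty on `{f closed}` has probability `0`. -/
lemma prob_zero_eq_zero (p : E → R) {X : Set (Config E)}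
    (h : ∀ ω : Config E, ω f = false → ω ∉ X) : prob (Function.update p f 0) X = 0 := by
  rw [← prob_update_zero_inter_closedEdge p X f]
  have e : X ∩ closedEdge f = ∅ := by
    ext ω
    simp only [Set.mem_inter_iff, mem_closedEdge, Set.mem_empty_iff_false, iff_false, not_and]
    exact fun hx hc => h ω hc hx
  rw [e, prob_empty]

/-- An event not seeing `f` has the same probability under `p`, `p[f ↦ 0]`, `p[f ↦ 1]`. -/
lemma prob_free_eq (p : E → R) {X : Set (Config E)} (hX : DependsOn (· ∈ X) ({f}ᶜ : Set E)) :
    prob p X = prob (Function.update p f 0) X :=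
  (RootPairSep.prob_update_of_dependsOn p hX (by simp) 0).symm

/-- An event not seeing `f` has the same probability under `p[f ↦ 1]` and `p[f ↦ 0]`. -/
lemma prob_free_eq' (p : E → R) {X : Set (Config E)} (hX : DependsOn (· ∈ X) ({f}ᶜ : Set E)) :
    prob (Function.update p f 1) X = prob (Function.update p f 0) X := by
  rw [RootPairSep.prob_update_of_dependsOn p hX (by simp) 1,
    RootPairSep.prob_update_of_dependsOn p hX (by simp) 0]

end Prob

/-! ## The events of `Gc` with `u` in the place of `a₃` do not see the leaf edge -/

section DependsOn

variable {V : Type*} {E : Type*} {ends : E → Sym2 V} {a₃ u : V} {f : E}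
  (hf : ends f = s(a₃, u)) (hleaf : ∀ e, a₃ ∈ ends e → e = f) (h3u : a₃ ≠ u)
include hf hleaf h3u

/-- `Q = {a₂ ↮ a₁}` (as `avoidAll`) does not see `f`. -/
lemma dependsOn_Q {a₁ a₂ : V} (h1 : a₁ ≠ a₃) (h2 : a₂ ≠ a₃) :
    DependsOn (· ∈ avoidAll ends a₂ {a₁}) ({f}ᶜ : Set E) := by
  have e : avoidAll ends a₂ {a₁} = (connEvent ends a₂ a₁)ᶜ := by
    ext ω; simp only [mem_avoidAll, Finset.mem_singleton, forall_eq, Set.mem_compl_iff, mem_connEvent]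
  rw [e]
  exact dependsOn_compl (dependsOn_connEvent_leaf hf hleaf h3u h2 h1)

/-- `T = {a₁ ↮ a₂, u ∈ C₂}`-type events do not see `f`. -/
lemma dependsOn_T {x y : V} (hx : x ≠ a₃) (hy : y ≠ a₃) (hu : u ≠ a₃) :
    DependsOn (· ∈ TEvent ends x y u) ({f}ᶜ : Set E) :=
  dependsOn_inter_same (dependsOn_compl (dependsOn_connEvent_leaf hf hleaf h3u hy hx))
    (dependsOn_connEvent_leaf hf hleaf h3u hy hu)

/-- `PD = {a₁ ↮ a₂, u ∉ C₁ ∪ C₂}` does not see `f`. -/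
lemma dependsOn_PD {a₁ a₂ : V} (h1 : a₁ ≠ a₃) (h2 : a₂ ≠ a₃) (hu : u ≠ a₃) :
    DependsOn (· ∈ PDEvent ends a₁ a₂ u) ({f}ᶜ : Set E) :=
  dependsOn_inter_same (dependsOn_compl (dependsOn_connEvent_leaf hf hleaf h3u h1 h2))
    (dependsOn_compl (dependsOn_union (dependsOn_connEvent_leaf hf hleaf h3u hu h1)
      (dependsOn_connEvent_leaf hf hleaf h3u hu h2) |>.mono (by simp)))

end DependsOn

end PMPendant

end Summit.Ventures.PercRepro2
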